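import Summits.QuantumFields.YangMills.Theorems.AllWindowsColdBoxBoxHighLineCubicCutInsideFP
import Summits.QuantumFields.YangMills.Theorems.AllWindowsColdBoxBoxHighLineTiltSupBoundsBeta

/-!
# The cubic cut in the assembly's letters: `∫_{D ∩ E} w_J ≤ β^{−q}·∫_{D ∖ E} w_J` for `β ≥ β₀`, with the moment order `k = k(β)` OPTIMISED
# (U5-BLOCKERS §2 L4, planner ym-idea-2 g18; LINE-20 U5 ⟨stmt-QuantumFields-24336⟩; U5 prep, helper-grade; U5 OPEN)

Width seat `ym-line-sfw-p2-w4` (prover-ym-line-sfw-p2-w4-g29-0).  ✓`SmallFieldFP.cubicCutInsideFP` (w4 g29) bounds the FP-weight of the cubic cut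
`E = {1 + C₅βH⁴s⁵ ≤ |cubicVertex β H ·|}` inside `D = smallField H s` by `2·e^{C·s·H⁵}·p_k·∫_{D∖E} w_J` for EVERY moment order `k ≥ 1`,
`p_k = (2k−1)^{3k}(8C₅H⁴(1+log H)³/β)^k`.  In the U5 letters (`s = β^{−1/2+κ₃}`, `H ≤ β^θ + 1`) the bracket is `e^{Cβ^{5θ−1/2+κ₃}}`, unbounded near
`θ = 1/10`, so NO FIXED `k` works; with `k = k(β) := ⌈T⌉₊`, `T = (C⁺sH⁵ + q·log β + 2·log 2)/log 2`, one has `p_k ≤ (8k³X)^k ≤ 4^{−k}` as soon as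
`216·X·W³ ≤ 1/4` (`X = 8C₅H⁴(1+log H)³/β`, `W = C⁺sH⁵ + q(1+log β) + 2 ≥ T/2`), and `2e^{CsH⁵}2^{−k} ≤ β^{−q}`.  That condition is eventually true iff the worst monomial
`H¹⁹(1+log H)³·s³/β = H¹⁹(1+log H)³/β^{5/2−3κ₃}` decays, i.e. **`19θ + 3κ₃ < 5/2`** (`κ₃ < 5/6 − 19θ/3`, `= 0.2` at `θ = 1/10`):

  ★★ **`SmallFieldFP.exists_beta0_cubicCut`** — for `0 < θ`, `0 < κ₃`, `2θ + κ₃ < 1/2`, `19θ + 3κ₃ < 5/2`, `0 ≤ q` there are `C₅ ≥ 0`, `β₀ ≥ 1` with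
  `∫_{smallField H s ∩ E} w_J ≤ β^{−q}·∫_{smallField H s ∖ E} w_J` for all `β ≥ β₀`, `1 ≤ H ≤ β^θ + 1`, `r ≥ s`, `s = β^{−1/2+κ₃}`, `w_J = fpChartWeight β H r`.

Everything proved; no definitions; standard axioms.  HONEST LABEL: U5 prep, helper-grade (lift L4 of the NEXT rung U5 of a critic-PASSed DRAFT line); U5 ⟨24336⟩,
⟨24004⟩ and the seat's own crux ⟨22884⟩ remain OPEN; no stub is closed by name, no crux, rung or summit is proved; **the Yang–Mills mass gap is NOT proved by
this file; no summit is proved by a line.**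
-/

set_option autoImplicit false

open MeasureTheory Real Finset

namespace Summit.QuantumFields.YangMills.Theorems.AllWindowsColdBoxBoxHighLine

namespace SmallFieldFP

open TiltSup

variable {H : ℕ}

/-! ## Arithmetic of the optimised moment order (opaque reals) -/

/-- `(a + b + 2)³ ≤ 9·(a³ + b³ + 8)` for `a, b ≥ 0` (power mean, the shape of `W³` below). -/
theorem add_add_two_pow_three_le {a b : ℝ} (ha : 0 ≤ a) (hb : 0 ≤ b) : (a + b + 2) ^ 3 ≤ 9 * (a ^ 3 + b ^ 3 + 8) := by
  nlinarith [sq_nonneg (a - b), sq_nonneg (b - 2), sq_nonneg (a - 2), mul_nonneg ha hb,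
    mul_nonneg (mul_nonneg ha hb) (by norm_num : (0:ℝ) ≤ 2), sq_nonneg (a + b - 2 * 2), sq_nonneg (a + 2 - 2 * b), sq_nonneg (b + 2 - 2 * a)]

/-- **The tail at the optimised order**: for a natural `k` with `8·k³·X ≤ ρ` (`X ≥ 0`), `(2k−1)^{3k}·X^k ≤ ρ^k`. -/
theorem moment_tail_le_pow {X ρ : ℝ} (hX : 0 ≤ X) {k : ℕ} (hk : 1 ≤ k) (hkX : 8 * (k : ℝ) ^ 3 * X ≤ ρ) :
    (2 * k - 1 : ℝ) ^ (k * 3) * X ^ k ≤ ρ ^ k := by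
  have hk1 : (1 : ℝ) ≤ k := by exact_mod_cast hk
  have h1 : (2 * k - 1 : ℝ) ^ (k * 3) ≤ (2 * k : ℝ) ^ (k * 3) := pow_le_pow_left₀ (by linarith) (by linarith) _
  have h2 : (2 * k : ℝ) ^ (k * 3) * X ^ k = (8 * (k : ℝ) ^ 3 * X) ^ k := by
    rw [mul_pow, mul_comm k 3, pow_mul]; ring
  calc (2 * k - 1 : ℝ) ^ (k * 3) * X ^ k ≤ (2 * k : ℝ) ^ (k * 3) * X ^ k := mul_le_mul_of_nonneg_right h1 (pow_nonneg hX _)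
    _ = (8 * (k : ℝ) ^ 3 * X) ^ k := h2
    _ ≤ ρ ^ k := pow_le_pow_left₀ (by positivity) hkX k

/-- **The optimised order beats the bracket**: if `k ≥ T = (A + q·log β + 2·log 2)/log 2` then `2·e^A·(1/2)^k ≤ β^{−q}` (`β > 0`). -/
theorem two_mul_exp_mul_half_pow_le {A q β : ℝ} (hβ : 0 < β) {k : ℕ} (hk : (A + q * Real.log β + 2 * Real.log 2) / Real.log 2 ≤ k) :
    2 * Real.exp A * (1 / 2 : ℝ) ^ k ≤ β ^ (-q) := by
  have hlog2 : 0 < Real.log 2 := Real.log_pos (by norm_num)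
  have hk' : A + q * Real.log β + 2 * Real.log 2 ≤ k * Real.log 2 := by rwa [div_le_iff₀ hlog2] at hk
  have hhalf : (1 / 2 : ℝ) ^ k = Real.exp (-((k : ℝ) * Real.log 2)) := by
    rw [← Real.rpow_natCast, Real.rpow_def_of_pos (by norm_num : (0 : ℝ) < 1 / 2), one_div, Real.log_inv]
    ring_nf
  have h2 : 2 * Real.exp A * (1 / 2 : ℝ) ^ k = Real.exp (Real.log 2 + A + -((k : ℝ) * Real.log 2)) := by
    rw [hhalf, Real.exp_add, Real.exp_add, Real.exp_log (by norm_num : (0:ℝ) < 2)]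
  rw [h2, Real.rpow_def_of_pos hβ]
  exact Real.exp_le_exp.2 (by nlinarith)

/-- `(β^{−1/2+κ})³ = 1/β^{3/2−3κ}` (`β > 0`). -/
theorem rpow_cube_eq {β κ : ℝ} (hβ : 0 < β) : (β ^ (-1 / 2 + κ)) ^ 3 = 1 / β ^ (3 / 2 - 3 * κ) := by
  rw [← Real.rpow_natCast (β ^ (-1 / 2 + κ)) 3, ← Real.rpow_mul hβ.le, one_div, ← Real.rpow_neg hβ.le]
  congr 1
  push_cast
  ring

/-- `β·(β^{−1/2+κ})² = β^{2κ}` (`β > 0`). -/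
theorem beta_mul_rpow_sq {β κ : ℝ} (hβ : 0 < β) : β * (β ^ (-1 / 2 + κ)) ^ 2 = β ^ (2 * κ) := by
  rw [← Real.rpow_natCast (β ^ (-1 / 2 + κ)) 2, ← Real.rpow_mul hβ.le]
  conv_lhs => rw [show β * β ^ ((-1 / 2 + κ) * ((2 : ℕ) : ℝ)) = β ^ (1 : ℝ) * β ^ ((-1 / 2 + κ) * ((2 : ℕ) : ℝ)) by rw [Real.rpow_one]]
  rw [← Real.rpow_add hβ]
  congr 1
  push_cast
  ring

/-! ## The cubic cut for `β ≥ β₀` -/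
set_option maxHeartbeats 400000 in
/-- ★★ **The cubic cut in the assembly's letters.**  For `0 < θ`, `0 < κ₃`, `2θ + κ₃ < 1/2`, `19θ + 3κ₃ < 5/2` and `q ≥ 0` there are `C₅ ≥ 0` and `β₀ ≥ 1`
such that for all `β ≥ β₀`, all `H : ℕ` with `1 ≤ H ≤ β^θ + 1` and all `r ≥ s := β^{−1/2+κ₃}`, with `E = {a | 1 + C₅·β·H⁴·s⁵ ≤ |cubicVertex β H a|}`:
`∫_{smallField H s ∩ E} w_J ≤ β^{−q} · ∫_{smallField H s ∖ E} w_J` (`w_J = fpChartWeight β H r`; moment order `k(β) = ⌈(C⁺sH⁵ + q log β + 2 log 2)/log 2⌉₊`). -/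
theorem exists_beta0_cubicCut {θ κ₃ q : ℝ} (hθ : 0 < θ) (hκ0 : 0 < κ₃) (h2 : 2 * θ + κ₃ < 1 / 2) (hwin : 19 * θ + 3 * κ₃ < 5 / 2)
    (hq : 0 ≤ q) :
    ∃ C₅ β₀ : ℝ, 0 ≤ C₅ ∧ 1 ≤ β₀ ∧ ∀ β : ℝ, β₀ ≤ β → ∀ H : ℕ, 1 ≤ H → (H : ℝ) ≤ β ^ θ + 1 → ∀ r : ℝ, β ^ (-1 / 2 + κ₃) ≤ r →
      ∫ a in smallField H (β ^ (-1 / 2 + κ₃)) ∩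
          {a | 1 + C₅ * β * (H : ℝ) ^ 4 * (β ^ (-1 / 2 + κ₃)) ^ 5 ≤ |cubicVertex β H a|}, fpChartWeight β H r a ≤
        β ^ (-q) * ∫ a in smallField H (β ^ (-1 / 2 + κ₃)) \
          {a | 1 + C₅ * β * (H : ℝ) ^ 4 * (β ^ (-1 / 2 + κ₃)) ^ 5 ≤ |cubicVertex β H a|}, fpChartWeight β H r a := by
  obtain ⟨C, C₅, c₀, hc₀, hC₅, hcut⟩ := cubicCutInsideFP
  have hθ0 : 0 ≤ θ := hθ.le
  set Cp : ℝ := max C 0 with hCp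
  have hCp0 : 0 ≤ Cp := le_max_right _ _
  have hCCp : C ≤ Cp := le_max_left _ _
  -- the four thresholds (all by ✓`ErrorBudget.exists_forall_natPow_log_le`):
  -- (t0) premise `s·H² ≤ c₀`:  `1·H²/β^{1/2−κ₃} ≤ c₀`  (`2θ < 1/2 − κ₃`)
  obtain ⟨b₀, hb₀1, hb₀⟩ := ErrorBudget.exists_forall_natPow_log_le (k := 2) (γ := 1 / 2 - κ₃) hθ0 (by push_cast; linarith) hc₀ 1 0 0
  -- (tC) premise `C(1 + log H) ≤ β s² = β^{2κ₃}`:  `C·H⁰·(1+log H)/β^{2κ₃} ≤ 1`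
  obtain ⟨b₁, hb₁1, hb₁⟩ := ErrorBudget.exists_forall_natPow_log_le (k := 0) (γ := 2 * κ₃) hθ0 (by push_cast; linarith) one_pos C 1 0
  -- (t2)..(t4): with `X = 8C₅H⁴(1+log H)³/β`, `T ≤ 2W`, `W = C⁺sH⁵ + q(1+log β) + 2`, `k' ≤ 3W`, `8k'³X ≤ 216·X·W³`:
  -- the three monomials of `216·X·W³ ≤ 1/4`: `W³ ≤ 9·((Cp·s·H⁵)³ + (q(1+log β))³ + 8)` and `s³ = 1/β^{3/2−3κ₃}`
  have h16 : (0 : ℝ) < 1 / 12 := by norm_num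
  obtain ⟨b₂, hb₂1, hb₂⟩ := ErrorBudget.exists_forall_natPow_log_le (k := 19) (γ := 5 / 2 - 3 * κ₃) hθ0 (by push_cast; linarith) h16
    (15552 * C₅ * Cp ^ 3) 3 0
  obtain ⟨b₃, hb₃1, hb₃⟩ := ErrorBudget.exists_forall_natPow_log_le (k := 4) (γ := 1) hθ0 (by push_cast; linarith) h16
    (15552 * C₅ * q ^ 3) 3 3
  obtain ⟨b₄, hb₄1, hb₄⟩ := ErrorBudget.exists_forall_natPow_log_le (k := 4) (γ := 1) hθ0 (by push_cast; linarith) h16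
    (124416 * C₅) 3 0
  refine ⟨C₅, max (max b₀ b₁) (max b₂ (max b₃ b₄)), hC₅, le_max_of_le_left (le_max_of_le_left hb₀1), ?_⟩
  intro β hβ H hH hHβ r hsr
  have hβ0 : b₀ ≤ β := ((le_max_left _ _).trans (le_max_left _ _)).trans hβ
  have hβ1 : b₁ ≤ β := ((le_max_right _ _).trans (le_max_left _ _)).trans hβ
  have hβ2 : b₂ ≤ β := ((le_max_left _ _).trans (le_max_right _ _)).trans hβ
  have hβ3 : b₃ ≤ β := (((le_max_left _ _).trans (le_max_right _ _)).trans (le_max_right _ _)).trans hβ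
  have hβ4 : b₄ ≤ β := (((le_max_right _ _).trans (le_max_right _ _)).trans (le_max_right _ _)).trans hβ
  have hβone : 1 ≤ β := hb₀1.trans hβ0
  have hβpos : 0 < β := by linarith
  have hH' : (1 : ℝ) ≤ H := by exact_mod_cast hH
  have hlogH : 0 ≤ Real.log H := Real.log_nonneg hH'
  have hlogβ : 0 ≤ Real.log β := Real.log_nonneg hβone
  set s : ℝ := β ^ (-1 / 2 + κ₃) with hs
  have hspos : 0 < s := Real.rpow_pos_of_pos hβpos _
  have hs1 : s ≤ 1 := rpow_neg_half_add_le_one hβone (by linarith)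
  -- premises of `cubicCutInsideFP`
  have hsH : s * (H : ℝ) ^ 2 ≤ c₀ := by
    have e : s * (H : ℝ) ^ 2 = 1 * (H : ℝ) ^ 2 * (1 + Real.log H) ^ 0 * (1 + Real.log β) ^ 0 / β ^ (1 / 2 - κ₃) := by
      rw [hs, rpow_eq_one_div hβpos, pow_zero, pow_zero]; ring
    rw [e]; exact hb₀ β hβ0 H hH hHβ
  have hCβ : C * (1 + Real.log H) ≤ β * s ^ 2 := by
    have h := hb₁ β hβ1 H hH hHβ
    rw [pow_zero, pow_one, pow_zero, mul_one, mul_one, div_le_one (Real.rpow_pos_of_pos hβpos _)] at h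
    rw [hs, beta_mul_rpow_sq hβpos]
    exact h
  -- the optimised moment order `k' = max ⌈T⌉₊ 1`
  set A : ℝ := C * s * (H : ℝ) ^ 5 with hA
  set T : ℝ := (A + q * Real.log β + 2 * Real.log 2) / Real.log 2 with hT
  have hlog2 : 0 < Real.log 2 := Real.log_pos (by norm_num)
  have hlog2' : 1 / 2 < Real.log 2 := by have := Real.log_two_gt_d9; linarith
  have hlog2'' : Real.log 2 < 1 := by have := Real.log_two_lt_d9; linarith
  have hACp : A ≤ Cp * s * (H : ℝ) ^ 5 := by
    rw [hA]; exact mul_le_mul_of_nonneg_right (mul_le_mul_of_nonneg_right hCCp hspos.le) (by positivity)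
  have hA0' : 0 ≤ Cp * s * (H : ℝ) ^ 5 := by positivity
  set W : ℝ := Cp * s * (H : ℝ) ^ 5 + q * (1 + Real.log β) + 2 with hW
  have hqlog : 0 ≤ q * (1 + Real.log β) := mul_nonneg hq (by linarith)
  have hW2 : 2 ≤ W := by rw [hW]; linarith
  have hnum : A + q * Real.log β + 2 * Real.log 2 ≤ W := by
    rw [hW]; nlinarith [mul_nonneg hq hlogβ]
  have hTW : T ≤ 2 * W := by
    rw [hT, div_le_iff₀ hlog2]
    nlinarith
  set k : ℕ := ⌈T⌉₊ with hk
  have hkT : T ≤ (k : ℝ) := Nat.le_ceil T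
  have hkle : (k : ℝ) ≤ 2 * W + 1 := by
    rcases le_or_gt 0 T with hT0 | hT0
    · have h := Nat.ceil_lt_add_one hT0
      rw [← hk] at h
      linarith
    · have h0 : k = 0 := by rw [hk]; exact Nat.ceil_eq_zero.2 hT0.le
      rw [h0]; push_cast; linarith
  set k' : ℕ := max k 1 with hk'
  have hk'1 : 1 ≤ k' := le_max_right _ _
  have hk'T : T ≤ (k' : ℝ) := hkT.trans (by exact_mod_cast le_max_left k 1)
  have hk'3W : (k' : ℝ) ≤ 3 * W := by
    rcases le_or_gt 1 k with h1 | h1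
    · rw [hk', max_eq_left h1]; linarith
    · have : k' = 1 := by rw [hk']; exact max_eq_right (by omega)
      rw [this]; push_cast; linarith
  -- `X` and `8 k'³ X ≤ 1/4`
  set X : ℝ := 8 * (C₅ * (H : ℝ) ^ 4 * (1 + Real.log H) ^ 3) / β with hX
  have hX0 : 0 ≤ X := by positivity
  have hW3 : W ^ 3 ≤ 9 * ((Cp * s * (H : ℝ) ^ 5) ^ 3 + (q * (1 + Real.log β)) ^ 3 + 2 ^ 3) := by
    have h := add_add_two_pow_three_le hA0' hqlog
    rw [hW]
    norm_num at h ⊢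
    exact h
  have hm1 := hb₂ β hβ2 H hH hHβ
  have hm2 := hb₃ β hβ3 H hH hHβ
  have hm3 := hb₄ β hβ4 H hH hHβ
  have e1 : 216 * X * (9 * (Cp * s * (H : ℝ) ^ 5) ^ 3) =
      15552 * C₅ * Cp ^ 3 * (H : ℝ) ^ 19 * (1 + Real.log H) ^ 3 * (1 + Real.log β) ^ 0 / β ^ (5 / 2 - 3 * κ₃) := by
    rw [pow_zero, hX, hs]
    have hc := rpow_cube_eq (κ := κ₃) hβpos
    have hβ52 : β ^ (5 / 2 - 3 * κ₃) = β * β ^ (3 / 2 - 3 * κ₃) := by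
      rw [show (5 / 2 - 3 * κ₃ : ℝ) = 1 + (3 / 2 - 3 * κ₃) by ring, Real.rpow_add hβpos, Real.rpow_one]
    rw [hβ52]
    have hne : β ^ (3 / 2 - 3 * κ₃) ≠ 0 := (Real.rpow_pos_of_pos hβpos _).ne'
    calc 216 * (8 * (C₅ * (H : ℝ) ^ 4 * (1 + Real.log H) ^ 3) / β) * (9 * (Cp * β ^ (-1 / 2 + κ₃) * (H : ℝ) ^ 5) ^ 3)
        = 216 * 9 * 8 * C₅ * Cp ^ 3 * (H : ℝ) ^ 19 * (1 + Real.log H) ^ 3 * (β ^ (-1 / 2 + κ₃)) ^ 3 / β := by ring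
      _ = 216 * 9 * 8 * C₅ * Cp ^ 3 * (H : ℝ) ^ 19 * (1 + Real.log H) ^ 3 * (1 / β ^ (3 / 2 - 3 * κ₃)) / β := by rw [hc]
      _ = _ := by field_simp; ring
  have e2 : 216 * X * (9 * (q * (1 + Real.log β)) ^ 3) =
      15552 * C₅ * q ^ 3 * (H : ℝ) ^ 4 * (1 + Real.log H) ^ 3 * (1 + Real.log β) ^ 3 / β ^ (1 : ℝ) := by
    rw [Real.rpow_one, hX]; ring
  have e3 : 216 * X * (9 * (2 : ℝ) ^ 3) =
      124416 * C₅ * (H : ℝ) ^ 4 * (1 + Real.log H) ^ 3 * (1 + Real.log β) ^ 0 / β ^ (1 : ℝ) := by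
    rw [Real.rpow_one, pow_zero, hX]; ring
  have hXW : 216 * X * W ^ 3 ≤ 1 / 4 := by
    calc 216 * X * W ^ 3 ≤ 216 * X * (9 * ((Cp * s * (H : ℝ) ^ 5) ^ 3 + (q * (1 + Real.log β)) ^ 3 + 2 ^ 3)) :=
          mul_le_mul_of_nonneg_left hW3 (by positivity)
      _ = 216 * X * (9 * (Cp * s * (H : ℝ) ^ 5) ^ 3) + 216 * X * (9 * (q * (1 + Real.log β)) ^ 3) + 216 * X * (9 * (2 : ℝ) ^ 3) := by ring
      _ ≤ 1 / 12 + 1 / 12 + 1 / 12 := by rw [e1, e2, e3]; exact add_le_add (add_le_add hm1 hm2) hm3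
      _ = 1 / 4 := by norm_num
  have hkX : 8 * (k' : ℝ) ^ 3 * X ≤ 1 / 4 := by
    have h1 : (k' : ℝ) ^ 3 ≤ (3 * W) ^ 3 := pow_le_pow_left₀ (Nat.cast_nonneg _) hk'3W 3
    calc 8 * (k' : ℝ) ^ 3 * X ≤ 8 * (3 * W) ^ 3 * X := by gcongr
      _ = 216 * X * W ^ 3 := by ring
      _ ≤ 1 / 4 := hXW
  -- the tail `p ≤ (1/4)^{k'} ≤ 1/4` and `≤ (1/2)^{k'}`
  have hp : (2 * k' - 1 : ℝ) ^ (k' * 3) * X ^ k' ≤ (1 / 4 : ℝ) ^ k' := moment_tail_le_pow hX0 hk'1 hkX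
  have hp4 : (2 * k' - 1 : ℝ) ^ (k' * 3) * X ^ k' / (1 : ℝ) ^ (2 * k') ≤ 1 / 4 := by
    rw [one_pow, div_one]
    exact hp.trans (pow_le_of_le_one (by norm_num) (by norm_num) (by omega))
  have hphalf : (2 * k' - 1 : ℝ) ^ (k' * 3) * X ^ k' / (1 : ℝ) ^ (2 * k') ≤ (1 / 2 : ℝ) ^ k' := by
    rw [one_pow, div_one]
    exact hp.trans (pow_le_pow_left₀ (by norm_num) (by norm_num) k')
  -- apply the cut
  have hmain := hcut H hH β r s hβpos hspos hsr hsH hCβ 1 one_pos k' hk'1 hp4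
  have hIden : 0 ≤ ∫ a in smallField H s \ {a | 1 + C₅ * β * (H : ℝ) ^ 4 * s ^ 5 ≤ |cubicVertex β H a|}, fpChartWeight β H r a :=
    setIntegral_nonneg ((ChartGauss.measurableSet_smallField _).diff (measurableSet_cubicCut β C₅ s 1))
      fun a _ => FPChart.fpChartWeight_nonneg β r a
  have hbr : 2 * Real.exp (C * s * (H : ℝ) ^ 5) *
      ((2 * k' - 1 : ℝ) ^ (k' * 3) * (8 * (C₅ * (H : ℝ) ^ 4 * (1 + Real.log H) ^ 3) / β) ^ k' / (1 : ℝ) ^ (2 * k')) ≤ β ^ (-q) := by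
    have h2 := two_mul_exp_mul_half_pow_le (A := A) (q := q) hβpos hk'T
    refine le_trans ?_ h2
    rw [hA]
    exact mul_le_mul_of_nonneg_left hphalf (by positivity)
  exact hmain.trans (mul_le_mul_of_nonneg_right hbr hIden)

end SmallFieldFP

end Summit.QuantumFields.YangMills.Theorems.AllWindowsColdBoxBoxHighLine
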